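import Summits.BirchSwinnertonDyer.Rank1Residual.X11b.ZpLineIndex
import Summits.BirchSwinnertonDyer.Rank1Residual.X11b.BDPRouteLocalKernelAlgebra
import Literature.NumberTheory.EllipticCurves.BSDRootNumberSmallConductorProofs
import HarnessLib

/-!
# The `ℤ_p`-line lemma WITH torsion: `Ψ(G) = p^m ℤ_p` with `p^m = #G[p^∞]`,
# `[G : T + p^k G] = p^k`, `[G : T + p^k G + ℤQ] = p^{min(k, v(ΨQ) − m)}`, `[G : p^kG + ℤQ] ≤ p^{min(k, v(ΨQ) − m)} · #G[p^∞]`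
# (cell `b2b-bsdres`, sub-cell `multr1-p2`, gen 17 — pure algebra behind the local index at `p` without (iv))

HONEST FRAMING (verbatim, cell `b2b-bsdres`): the goal of the cell is to DELETE the
COMBINATION-SHAPED residual classes for ALL analytic-rank `≤ 1` curves over `ℚ` — "full BSD
formula for every rank `≤ 1` curve in class `C`" assembled STRICTLY from published theorems — so
that the rank-`≤ 1` remainder becomes exactly the CONSTRUCTION-SHAPED classes, which are TYPED
(missing-input Props), NOT attempted; this is not "finishing BSD". Research route `p2` for class
X11b; no claim beyond the stated class; nothing booked; X11b stays CONSTRUCTION-SHAPED. Theorems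
only; no definition; no named fact; no `sorry`. Continues `ZpLineIndex.lean` (gen 15), whose index
formula assumed NO `p`-torsion (the erratum's (iv) `E(ℚ_p)[p] = 0`).

## Content (namespace `Summit.BirchSwinnertonDyer.Rank1Residual.X11b.LocalIndex`)

`G` abelian, `E ≤ G` of finite index with `φ : E ≃+ ℤ_p`, `Ψ = psi E φ : G →+ ℤ_p` (`Ψ g = φ([G:E]•g)`,
kernel = torsion `T`, gen 15), `T` finite. With `p`-torsion allowed:

* `exists_eq_span_pow_of_span_pow_le` — an additive subgroup of `ℤ_p` containing some `p^j ℤ_p` is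
  `p^i ℤ_p` (minimal valuation + gen 15's `p^k ℤ_p + ℤx = p^{min(k, v(x))} ℤ_p`).
* **`range_psi_eq_span_pow`**: `Ψ(G) = p^m ℤ_p` with **`p^m = #G[p^∞]`** (the `p`-primary torsion):
  `[G : E ⊔ T]·#T = [G:E] = p^j N'`, `[G : E ⊔ T]·p^m = p^j`, so `#T = N' p^m` and `#T[p^∞] = p^m`.
* `index_torsion_sup_range_nsmul` — `[G : T ⊔ p^kG] = p^k`;
  **`index_torsion_sup_range_nsmul_sup_zmultiples`** — `[G : T ⊔ (p^kG + ℤQ)] = p^{min(k, v(ΨQ) − m)}`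
  (`Q` of infinite order; `v(ΨQ) ≥ m`);
  **`index_range_nsmul_sup_zmultiples_le`** — `[G : p^kG + ℤQ] ≤ p^{min(k, v(ΨQ) − m)} · #G[p^∞]`
  (`[p^kG + ℤQ + T : p^kG + ℤQ] ≤ [T : p^kT] = #T[p^k] ≤ #G[p^∞]`).

Consumer: the local index at `p` of Castella 2018 (calcul) / JSW 2017 (7.1.5) WITHOUT (iv), i.e. with
the factor `#H⁰(K_𝔭, E[p^∞]) = #E(ℚ_p)[p^∞]` kept (`G = E(ℚ_p)`, `E = E⁽²⁾(ℚ_p)`); route p2 gen 17.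

References: [Castella2018] proof of Thm. 2.3, (calcul) (arXiv:1704.06608 p. 6);
[JetchevSkinnerWan2017] (7.1.5); [SilvermanAEC2009] VII.6.3.
-/

noncomputable section

open scoped Classical

namespace Summit.BirchSwinnertonDyer.Rank1Residual.X11b.LocalIndex

variable {p : ℕ} [Fact p.Prime]

/-! ## §1 Subgroups of `ℤ_p` containing `p^j ℤ_p` -/

section Zp

/-- `p^a ℤ_p ≤ p^b ℤ_p` for `b ≤ a`. [folklore] -/
theorem span_pow_le_span_pow {a b : ℕ} (h : b ≤ a) :
    (Ideal.span {(p : ℤ_[p]) ^ a}).toAddSubgroup ≤ (Ideal.span {(p : ℤ_[p]) ^ b}).toAddSubgroup :=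
  fun _ hx ↦ Ideal.span_singleton_le_span_singleton.mpr (pow_dvd_pow _ h) hx

/-- `p^k • (p^i ℤ_p) = p^{i+k} ℤ_p`. [folklore] -/
theorem map_nsmul_span_pow (i k : ℕ) :
    (Ideal.span {(p : ℤ_[p]) ^ i}).toAddSubgroup.map (nsmulAddMonoidHom (p ^ k) : ℤ_[p] →+ ℤ_[p]) =
      (Ideal.span {(p : ℤ_[p]) ^ (i + k)}).toAddSubgroup := by
  ext y
  constructor
  · rintro ⟨x, hx, rfl⟩
    obtain ⟨z, rfl⟩ := (mem_span_pow_iff i x).mp hx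
    rw [nsmulAddMonoidHom_apply, nsmul_eq_mul, mem_span_pow_iff]
    exact ⟨z, by push_cast; ring⟩
  · intro hy
    obtain ⟨z, rfl⟩ := (mem_span_pow_iff (i + k) y).mp hy
    refine ⟨(p : ℤ_[p]) ^ i * z, (mem_span_pow_iff i _).mpr ⟨z, rfl⟩, ?_⟩
    rw [nsmulAddMonoidHom_apply, nsmul_eq_mul]; push_cast; ring

/-- `range (p^k • ·) = p^k ℤ_p` on `ℤ_p`. [folklore] -/
theorem range_nsmul_eq_span_pow (k : ℕ) :
    (nsmulAddMonoidHom (p ^ k) : ℤ_[p] →+ ℤ_[p]).range = (Ideal.span {(p : ℤ_[p]) ^ k}).toAddSubgroup := by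
  ext y
  rw [mem_span_pow_iff]
  constructor
  · rintro ⟨z, rfl⟩; exact ⟨z, by rw [nsmulAddMonoidHom_apply, nsmul_eq_mul]; push_cast; ring⟩
  · rintro ⟨z, rfl⟩; exact ⟨z, by rw [nsmulAddMonoidHom_apply, nsmul_eq_mul]; push_cast; ring⟩

/-- **An additive subgroup of `ℤ_p` containing some `p^j ℤ_p` is `p^i ℤ_p`** (`i` = the least
valuation of a non-zero element; `p^j ℤ_p + ℤ x₀ = p^{min(j, v(x₀))} ℤ_p`). [folklore] -/
theorem exists_eq_span_pow_of_span_pow_le {R : AddSubgroup ℤ_[p]} {j : ℕ}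
    (hR : (Ideal.span {(p : ℤ_[p]) ^ j}).toAddSubgroup ≤ R) :
    ∃ i : ℕ, R = (Ideal.span {(p : ℤ_[p]) ^ i}).toAddSubgroup := by
  classical
  have hpj : ((p : ℤ_[p]) ^ j) ≠ 0 := pow_ne_zero _ (NeZero.ne _)
  have hex : ∃ n : ℕ, ∃ x ∈ R, x ≠ 0 ∧ x.valuation = n :=
    ⟨_, (p : ℤ_[p]) ^ j, hR (Ideal.mem_span_singleton_self _), hpj, rfl⟩
  obtain ⟨x₀, hx₀R, hx₀, hv₀⟩ := Nat.find_spec hex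
  have hmin : ∀ x ∈ R, x ≠ 0 → Nat.find hex ≤ x.valuation := fun x hx hx0 ↦
    Nat.find_min' hex ⟨x, hx, hx0, rfl⟩
  refine ⟨Nat.find hex, le_antisymm ?_ ?_⟩
  · intro x hx
    by_cases hx0 : x = 0
    · rw [hx0]; exact AddSubgroup.zero_mem _
    · exact mem_span_pow_of_le_valuation hx0 (hmin x hx hx0)
  · -- `p^{i} ℤ_p ≤ p^{min(j, i)} ℤ_p = p^j ℤ_p + ℤ x₀ ≤ R`
    have hij : Nat.find hex ≤ j := by
      have := hmin _ (hR (Ideal.mem_span_singleton_self _)) hpj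
      rwa [PadicInt.valuation_pow, PadicInt.valuation_p, mul_one] at this
    have h1 : (nsmulAddMonoidHom (p ^ j) : ℤ_[p] →+ ℤ_[p]).range ⊔ AddSubgroup.zmultiples x₀ ≤ R := by
      refine sup_le ?_ (AddSubgroup.zmultiples_le.mpr hx₀R)
      rw [range_nsmul_eq_span_pow]; exact hR
    rw [range_nsmul_sup_zmultiples_eq hx₀ j, hv₀, min_eq_right hij] at h1
    exact h1

end Zp

/-! ## §2 `Ψ(G) = p^m ℤ_p`, `p^m = #G[p^∞]` -/

section Torsion

variable {G : Type*} [AddCommGroup G] (E : AddSubgroup G) [hE : E.FiniteIndex] (φ : E ≃+ ℤ_[p])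

/-- `ker Ψ` is the torsion subgroup. [folklore] -/
theorem ker_psi : (psi E φ).ker = AddCommGroup.torsion G := by
  ext g
  rw [AddMonoidHom.mem_ker, psi_eq_zero_iff]
  rfl

/-- The `p`-primary component of `G` is finite (it lies in the finite torsion subgroup). [folklore] -/
theorem finite_primaryComponent (φ : E ≃+ ℤ_[p]) : Finite (AddCommGroup.primaryComponent G p) := by
  haveI := finite_torsion E φ
  refine Finite.of_injective (fun x : AddCommGroup.primaryComponent G p ↦
    (⟨(x : G), ?_⟩ : AddCommGroup.torsion G)) ?_
  · obtain ⟨n, hn⟩ := (AddCommGroup.mem_primaryComponent).mp x.2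
    exact (AddCommGroup.mem_torsion _).mpr (isOfFinAddOrder_iff_nsmul_eq_zero.mpr
      ⟨p ^ n, pow_pos (Fact.out : p.Prime).pos n, hn⟩)
  · intro a b hab
    exact Subtype.ext (by simpa using congrArg (fun z : AddCommGroup.torsion G ↦ (z : G)) hab)

omit hE in
/-- `#G[p^∞] = #T[p^∞]` for the torsion subgroup `T` (same elements). [folklore] -/
theorem natCard_primaryComponent_torsion (G : Type*) [AddCommGroup G] (p : ℕ) [Fact p.Prime] :
    Nat.card (AddCommGroup.primaryComponent (AddCommGroup.torsion G) p) =
      Nat.card (AddCommGroup.primaryComponent G p) := by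
  refine Nat.card_congr ⟨fun x ↦ ⟨((x : AddCommGroup.torsion G) : G), ?_⟩, fun y ↦ ⟨⟨(y : G), ?_⟩, ?_⟩,
    fun x ↦ ?_, fun y ↦ ?_⟩
  · obtain ⟨n, hn⟩ := (AddCommGroup.mem_primaryComponent).mp x.2
    exact (AddCommGroup.mem_primaryComponent).mpr ⟨n, by
      have := congrArg (fun z : AddCommGroup.torsion G ↦ (z : G)) hn
      simpa using this⟩
  · obtain ⟨n, hn⟩ := (AddCommGroup.mem_primaryComponent).mp y.2
    exact (AddCommGroup.mem_torsion _).mpr (isOfFinAddOrder_iff_nsmul_eq_zero.mpr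
      ⟨p ^ n, pow_pos (Fact.out : p.Prime).pos n, hn⟩)
  · obtain ⟨n, hn⟩ := (AddCommGroup.mem_primaryComponent).mp y.2
    exact (AddCommGroup.mem_primaryComponent).mpr ⟨n, Subtype.ext (by simpa using hn)⟩
  · rfl
  · rfl

/-- **`Ψ(G) = p^m ℤ_p` with `p^m = #G[p^∞]`.** With `N = [G:E] = p^j N'` (`p ∤ N'`):
`Ψ(E) = N ℤ_p = p^j ℤ_p ≤ Ψ(G)`, so `Ψ(G) = p^m ℤ_p` for some `m ≤ j`; `Ψ⁻¹(p^j ℤ_p) = E + T`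
(`T = ker Ψ` = torsion) gives `N = [G : E + T] · #T` and `[G : E + T] · p^m = p^j`, whence
`#T = N' p^m` and `#T[p^∞] = p^m`. (Gen 15's `psi_surjective` is the case `m = 0`.) [folklore] -/
theorem range_psi_eq_span_pow :
    ∃ m : ℕ, (psi E φ).range = (Ideal.span {(p : ℤ_[p]) ^ m}).toAddSubgroup ∧
      p ^ m = Nat.card (AddCommGroup.primaryComponent G p) := by
  classical
  set f := psi E φ with hf
  set N := E.index with hN
  have hN0 : N ≠ 0 := hE.index_ne_zero
  obtain ⟨j, N', hN', hNeq⟩ := Nat.exists_eq_pow_mul_and_not_dvd hN0 p (Fact.out : p.Prime).ne_one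
  -- `N'` is a unit of `ℤ_p`
  have hu : IsUnit ((N' : ℕ) : ℤ_[p]) := by
    rw [PadicInt.isUnit_iff, PadicInt.norm_natCast_eq_one_iff]
    exact (Nat.Prime.coprime_iff_not_dvd Fact.out).mpr hN'
  obtain ⟨u, hu'⟩ := hu
  set S : AddSubgroup ℤ_[p] := (Ideal.span {(p : ℤ_[p]) ^ j}).toAddSubgroup with hS
  set T : AddSubgroup G := AddCommGroup.torsion G with hT
  haveI : Finite T := finite_torsion E φ
  -- (1) `S ≤ range f`
  have hSle : S ≤ f.range := by
    intro y hy
    obtain ⟨z, rfl⟩ := (mem_span_pow_iff j y).mp hy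
    refine ⟨((φ.symm (((u⁻¹ : ℤ_[p]ˣ) : ℤ_[p]) * z) : E) : G), ?_⟩
    rw [hf, psi_apply_of_mem E φ (φ.symm _).2]
    simp only [Subtype.coe_eta, AddEquiv.apply_symm_apply]
    rw [← hN, hNeq, Nat.cast_mul, Nat.cast_pow, ← hu']
    rw [mul_assoc, ← mul_assoc (u : ℤ_[p]), Units.mul_inv, one_mul]
  -- (2) `range f = p^m ℤ_p`
  obtain ⟨m, hm⟩ := exists_eq_span_pow_of_span_pow_le hSle
  have hidx : f.range.index = p ^ m := by rw [hm, index_span_pow]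
  have hSidx : S.index = p ^ j := index_span_pow j
  -- (3) `S.comap f = E ⊔ T`
  have hcomap : S.comap f = E ⊔ T := by
    apply le_antisymm
    · intro g hg
      rw [AddSubgroup.mem_comap] at hg
      obtain ⟨z, hz⟩ := (mem_span_pow_iff j _).mp hg
      set e' : G := ((φ.symm (((u⁻¹ : ℤ_[p]ˣ) : ℤ_[p]) * z) : E) : G) with he'
      have hfe' : f e' = f g := by
        rw [hz, hf, psi_apply_of_mem E φ (φ.symm _).2]
        simp only [Subtype.coe_eta, AddEquiv.apply_symm_apply]
        rw [← hN, hNeq, Nat.cast_mul, Nat.cast_pow, ← hu', mul_assoc, ← mul_assoc (u : ℤ_[p]),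
          Units.mul_inv, one_mul]
      have hker : f (g - e') = 0 := by rw [map_sub, hfe', sub_self]
      have htor : g - e' ∈ T := (psi_eq_zero_iff E φ _).mp hker
      rw [AddSubgroup.mem_sup]
      exact ⟨e', (φ.symm _).2, g - e', htor, by abel⟩
    · refine sup_le ?_ ?_
      · intro e he
        rw [AddSubgroup.mem_comap, hf, psi_apply_of_mem E φ he, ← hN, hNeq, mem_span_pow_iff]
        exact ⟨(N' : ℤ_[p]) * φ ⟨e, he⟩, by push_cast; ring⟩
      · intro t ht
        rw [AddSubgroup.mem_comap, (psi_eq_zero_iff E φ t).mpr ht]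
        exact S.zero_mem
  -- (4) counting
  have h1 : (S.comap f).index = S.relIndex f.range := AddSubgroup.index_comap S f
  have h2 : S.relIndex f.range * f.range.index = S.index := AddSubgroup.relIndex_mul_index hSle
  have h3 : E.relIndex (E ⊔ T) * (E ⊔ T).index = E.index := AddSubgroup.relIndex_mul_index le_sup_left
  have h4 : E.relIndex (E ⊔ T) = E.relIndex T := AddSubgroup.relIndex_sup_left _ _
  have h5 : Nat.card (E.addSubgroupOf T) * E.relIndex T = Nat.card T := AddSubgroup.card_mul_index _
  have h6 : Nat.card (E.addSubgroupOf T) = 1 := by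
    rw [hT, addSubgroupOf_torsion_eq_bot E φ]; exact AddSubgroup.card_bot
  rw [h6, one_mul] at h5
  have hA : Nat.card T * (E ⊔ T).index = N := by rw [← h5, ← h4, h3]
  have hB : (E ⊔ T).index * p ^ m = p ^ j := by rw [← hcomap, h1, ← hidx, h2, hSidx]
  have hC : Nat.card T * p ^ j = p ^ j * N' * p ^ m := by
    rw [← hNeq, ← hA, mul_assoc, hB]
  have hD : Nat.card T = N' * p ^ m := by
    have hpj : 0 < p ^ j := pow_pos (Fact.out : p.Prime).pos j
    apply Nat.eq_of_mul_eq_mul_right hpj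
    rw [hC]; ring
  -- (5) `#T[p^∞] = p^m`
  refine ⟨m, hm, ?_⟩
  have hN'0 : N' ≠ 0 := by rintro rfl; exact hN' (dvd_zero p)
  have hfac : (N' * p ^ m).factorization p = m := by
    rw [Nat.factorization_mul hN'0 (pow_ne_zero _ (Fact.out : p.Prime).ne_zero), Finsupp.add_apply,
      Nat.Prime.factorization_pow (Fact.out : p.Prime), Finsupp.single_eq_same,
      Nat.factorization_eq_zero_of_not_dvd hN', zero_add]
  rw [← natCard_primaryComponent_torsion G p,
    Literature.NumberTheory.EllipticCurves.card_addPrimaryComponent_eq_pow, ← hT, hD, hfac]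

/-! ## §3 Index formulas with torsion -/

/-- **`[G : T ⊔ p^k G] = p^k`.** (`Ψ` induces `G/T ≅ p^m ℤ_p`; `[p^m ℤ_p : p^{m+k} ℤ_p] = p^k`.) [folklore] -/
theorem index_torsion_sup_range_nsmul (E : AddSubgroup G) [E.FiniteIndex] (φ : E ≃+ ℤ_[p]) (k : ℕ) :
    (AddCommGroup.torsion G ⊔ (nsmulAddMonoidHom (p ^ k) : G →+ G).range).index = p ^ k := by
  obtain ⟨m, hm, -⟩ := range_psi_eq_span_pow E φ
  set f := psi E φ with hf
  set H := (nsmulAddMonoidHom (p ^ k) : G →+ G).range with hH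
  have hp : p.Prime := Fact.out
  have h1 : (H.map f).index = (H ⊔ f.ker).index * f.range.index := AddSubgroup.index_map H f
  have h2 : H.map f = (Ideal.span {(p : ℤ_[p]) ^ (m + k)}).toAddSubgroup := by
    rw [← map_nsmul_span_pow, ← hm]
    apply le_antisymm
    · rintro _ ⟨_, ⟨g, rfl⟩, rfl⟩
      exact ⟨f g, ⟨g, rfl⟩, by rw [nsmulAddMonoidHom_apply, nsmulAddMonoidHom_apply, map_nsmul]⟩
    · rintro _ ⟨_, ⟨g, rfl⟩, rfl⟩
      exact ⟨(p ^ k) • g, ⟨g, rfl⟩, by rw [nsmulAddMonoidHom_apply, map_nsmul]⟩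
  rw [h2, index_span_pow, hm, index_span_pow, ker_psi, pow_add, mul_comm] at h1
  rw [sup_comm]
  exact (Nat.eq_of_mul_eq_mul_right (pow_pos hp.pos m) h1.symm)

/-- `v(Ψ Q) ≥ m` for every `Q` (`Ψ Q ∈ Ψ(G) = p^m ℤ_p`), with `p^m = #G[p^∞]`. [folklore] -/
theorem exists_pow_eq_card_and_le_valuation_psi :
    ∃ m : ℕ, (psi E φ).range = (Ideal.span {(p : ℤ_[p]) ^ m}).toAddSubgroup ∧
      p ^ m = Nat.card (AddCommGroup.primaryComponent G p) ∧
      ∀ Q : G, psi E φ Q ≠ 0 → m ≤ (psi E φ Q).valuation := by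
  obtain ⟨m, hm, hcard⟩ := range_psi_eq_span_pow E φ
  refine ⟨m, hm, hcard, fun Q hQ ↦ ?_⟩
  have hmem : psi E φ Q ∈ (psi E φ).range := ⟨Q, rfl⟩
  rw [hm] at hmem
  obtain ⟨z, hz⟩ := (mem_span_pow_iff m _).mp hmem
  have hz0 : z ≠ 0 := by rintro rfl; rw [mul_zero] at hz; exact hQ hz
  rw [hz, PadicInt.valuation_p_pow_mul m z hz0]
  exact Nat.le_add_right m _

/-- **`[G : T ⊔ (p^k G + ℤQ)] = p^{min(k, v(ΨQ) − m)}`** for `Q` of infinite order, where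
`Ψ(G) = p^m ℤ_p` (`p^m = #G[p^∞]`): `Ψ(p^kG + ℤQ) = p^{m+k} ℤ_p + ℤ ΨQ = p^{min(m+k, v(ΨQ))} ℤ_p`.
[cite: Castella2018, proof of Thm. 2.3, (calcul) (arXiv:1704.06608 p. 6)] -/
theorem index_torsion_sup_range_nsmul_sup_zmultiples {m : ℕ}
    (hm : (psi E φ).range = (Ideal.span {(p : ℤ_[p]) ^ m}).toAddSubgroup)
    (Q : G) (hQ : ¬ IsOfFinAddOrder Q) (k : ℕ) :
    (AddCommGroup.torsion G ⊔ ((nsmulAddMonoidHom (p ^ k) : G →+ G).range ⊔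
        AddSubgroup.zmultiples Q)).index = p ^ min k ((psi E φ Q).valuation - m) := by
  set f := psi E φ with hf
  set H := (nsmulAddMonoidHom (p ^ k) : G →+ G).range ⊔ AddSubgroup.zmultiples Q with hH
  have hp : p.Prime := Fact.out
  have hx : f Q ≠ 0 := fun h ↦ hQ ((psi_eq_zero_iff E φ Q).mp h)
  -- `m ≤ v(ΨQ)`
  have hmv : m ≤ (f Q).valuation := by
    have hmem : f Q ∈ f.range := ⟨Q, rfl⟩
    rw [hm] at hmem
    obtain ⟨z, hz⟩ := (mem_span_pow_iff m _).mp hmem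
    have hz0 : z ≠ 0 := by rintro rfl; rw [mul_zero] at hz; exact hx hz
    rw [hz, PadicInt.valuation_p_pow_mul m z hz0]
    exact Nat.le_add_right m _
  have h1 : (H.map f).index = (H ⊔ f.ker).index * f.range.index := AddSubgroup.index_map H f
  -- `H.map f = p^{m+k} ℤ_p + ℤ f(Q)`
  have h2 : H.map f = (nsmulAddMonoidHom (p ^ (m + k)) : ℤ_[p] →+ ℤ_[p]).range ⊔
      AddSubgroup.zmultiples (f Q) := by
    rw [hH, AddSubgroup.map_sup, AddMonoidHom.map_zmultiples, range_nsmul_eq_span_pow,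
      ← map_nsmul_span_pow, ← hm]
    congr 1
    apply le_antisymm
    · rintro _ ⟨_, ⟨g, rfl⟩, rfl⟩
      exact ⟨f g, ⟨g, rfl⟩, by rw [nsmulAddMonoidHom_apply, nsmulAddMonoidHom_apply, map_nsmul]⟩
    · rintro _ ⟨_, ⟨g, rfl⟩, rfl⟩
      exact ⟨(p ^ k) • g, ⟨g, rfl⟩, by rw [nsmulAddMonoidHom_apply, map_nsmul]⟩
  rw [h2, index_range_nsmul_sup_zmultiples hx, hm, index_span_pow, ker_psi] at h1
  -- `p^{min(m+k, v)} = [G : H ⊔ T] · p^m`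
  have hmin : min (m + k) (f Q).valuation = m + min k ((f Q).valuation - m) := by
    rcases le_total k ((f Q).valuation - m) with h | h
    · rw [min_eq_left h, min_eq_left (by omega)]
    · rw [min_eq_right h, min_eq_right (by omega)]; omega
  rw [hmin, pow_add, mul_comm] at h1
  rw [sup_comm]
  exact Nat.eq_of_mul_eq_mul_right (pow_pos hp.pos m) h1.symm

/-- `[T : T ⊓ H] ≤ #G[p^∞]` for any subgroup `H ⊇ p^k G` (`T` the torsion subgroup): the index is
at most `[T : p^k T] = #T[p^k] ≤ #T[p^∞]`. [folklore] -/
theorem relIndex_torsion_le_natCard_primaryComponent (E : AddSubgroup G) [E.FiniteIndex]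
    (φ : E ≃+ ℤ_[p]) (k : ℕ) {H : AddSubgroup G}
    (hH : (nsmulAddMonoidHom (p ^ k) : G →+ G).range ≤ H) :
    H.relIndex (AddCommGroup.torsion G) ≤ Nat.card (AddCommGroup.primaryComponent G p) := by
  set T : AddSubgroup G := AddCommGroup.torsion G with hT
  haveI : Finite T := finite_torsion E φ
  haveI : Finite (AddCommGroup.primaryComponent G p) := finite_primaryComponent E φ
  -- multiplication by `p^k` on `T`
  let ψ : T →+ T := (nsmulAddMonoidHom (p ^ k) : T →+ T)
  -- `[T : range ψ] = #ker ψ ≤ #G[p^∞]`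
  have hk : Nat.card ψ.ker ≤ Nat.card (AddCommGroup.primaryComponent G p) := by
    refine Nat.card_le_card_of_injective (fun t ↦ ⟨((t : T) : G), ?_⟩) ?_
    · have ht : (p ^ k) • (t : T) = 0 := (AddMonoidHom.mem_ker).mp t.2
      refine (AddCommGroup.mem_primaryComponent).mpr ⟨k, ?_⟩
      have h := congrArg (fun z : T ↦ (z : G)) ht
      simp only [AddSubgroupClass.coe_nsmul, ZeroMemClass.coe_zero] at h
      exact h
    · intro a b hab
      apply Subtype.ext; apply Subtype.ext
      exact congrArg (fun z : AddCommGroup.primaryComponent G p ↦ (z : G)) hab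
  have hq : Nat.card (T ⧸ ψ.range) = Nat.card ψ.ker :=
    TamagawaCoinvariants.natCard_quotient_range_eq_natCard_ker ψ
  -- `range ψ ⊆ H ⊓ T` inside `T`
  have hle : ψ.range ≤ H.addSubgroupOf T := by
    rintro _ ⟨t, rfl⟩
    rw [AddSubgroup.mem_addSubgroupOf]
    exact hH ⟨(t : G), by simp [ψ]⟩
  have hdvd : (H.addSubgroupOf T).index ∣ ψ.range.index := AddSubgroup.index_dvd_of_le hle
  have hpos : 0 < ψ.range.index := Nat.pos_of_ne_zero AddSubgroup.FiniteIndex.index_ne_zero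
  calc H.relIndex T = (H.addSubgroupOf T).index := rfl
    _ ≤ ψ.range.index := Nat.le_of_dvd hpos hdvd
    _ = Nat.card (T ⧸ ψ.range) := AddSubgroup.index_eq_card _
    _ = Nat.card ψ.ker := hq
    _ ≤ Nat.card (AddCommGroup.primaryComponent G p) := hk

/-- **`[G : p^k G + ℤQ] ≤ p^{min(k, v(ΨQ) − m)} · #G[p^∞]`** (`Ψ(G) = p^m ℤ_p`, `Q` of infinite
order): `[G : H] = [G : H ⊔ T] · [T : T ⊓ H]`. [cite: Castella2018, proof of Thm. 2.3, (calcul) (arXiv:1704.06608 p. 6)] -/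
theorem index_range_nsmul_sup_zmultiples_le {m : ℕ}
    (hm : (psi E φ).range = (Ideal.span {(p : ℤ_[p]) ^ m}).toAddSubgroup)
    (Q : G) (hQ : ¬ IsOfFinAddOrder Q) (k : ℕ) :
    ((nsmulAddMonoidHom (p ^ k) : G →+ G).range ⊔ AddSubgroup.zmultiples Q).index ≤
      p ^ min k ((psi E φ Q).valuation - m) * Nat.card (AddCommGroup.primaryComponent G p) := by
  set T : AddSubgroup G := AddCommGroup.torsion G with hT
  set H := (nsmulAddMonoidHom (p ^ k) : G →+ G).range ⊔ AddSubgroup.zmultiples Q with hH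
  have h1 : H.relIndex (T ⊔ H) * (T ⊔ H).index = H.index := AddSubgroup.relIndex_mul_index le_sup_right
  have h2 : H.relIndex (T ⊔ H) = H.relIndex T := AddSubgroup.relIndex_sup_right _ _
  rw [← h1, h2, index_torsion_sup_range_nsmul_sup_zmultiples E φ hm Q hQ k, mul_comm]
  exact Nat.mul_le_mul_left _ (relIndex_torsion_le_natCard_primaryComponent E φ k le_sup_left)

end Torsion

end Summit.BirchSwinnertonDyer.Rank1Residual.X11b.LocalIndex

end
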